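import Literature.MathematicalPhysics.QuantumManyBody.BoseGasHardSet
import HarnessLib

/-!
# Hard layers and softened profiles of a pair potential (definitions)

Topic `Literature/MathematicalPhysics/QuantumManyBody`, sequel of `BoseGasHardSet.lean` (hard radii `hardRad v ⊆ [0, R₀]` of a
pair potential `v : ℝ → [0, ∞]`: the radii near which `v(|·|)` is not integrable). Vocabulary for the form-core theorem
of the periodic `N`-body problem with hard-core pair potentials (the `C¹` Bose core is a form core of the maximal form
`Q_v` also when `v(|·|) ∉ L¹_loc`, cf. B. Simon, J. Operator Theory 1 (1979) Thm. 2.1 for the `L¹_loc` case), whose proof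
cuts finite-energy functions off near the **hard configurations** and softens `v` near its hard radii:

* `pairRad L X i j n = |xᵢ - xⱼ - L n|` — the radius of the pair `(i, j)` seen through the lattice image `n ∈ ℤ³`
  (the arguments of `v` in the periodic interaction `∑_{i<j} ∑ₙ v(|xᵢ - xⱼ - Ln|)`);
* `hardLayer v L s` — the configurations one of whose pair-image radii lies within `s` of a hard radius
  (for `s = 0`: the hard configurations, where the periodic interaction is not locally integrable);
* `hardZone v L s` — the transition zone: some pair-image radius is within `3s` of, but not at, a hard radius;
* `awayProfile v θ = v · 1{dist(·, hardRad v) ≥ θ}` — the potential switched off within `θ` of its hard radii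
  (a profile with `awayProfile v θ (|·|) ∈ L¹(ℝ³)`, equal to `v` off the `θ`-neighbourhood of the hard radii).

Tagged folklore; context [LSSY2005] Ch. 2 (2.1) (hard cores allowed in the standing class of interactions).
-/

noncomputable section

open MeasureTheory Set Metric
open scoped ENNReal

namespace Literature.MathematicalPhysics.QuantumManyBody.BoseGas

variable {N : ℕ}

/-- The radius `|xᵢ - xⱼ - L n|` of the pair `(i, j)` through the lattice image `n ∈ ℤ³`. [folklore] -/
def pairRad (L : ℝ) (X : Config N) (i j : Fin N) (n : Fin 3 → ℤ) : ℝ :=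
  ‖X i - X j - latticeVec L n‖

/-- The **hard layer** of width `s`: configurations with a pair-image radius within `s` of a hard radius of `v`.
[folklore] -/
def hardLayer (v : ℝ → ℝ≥0∞) (L s : ℝ) : Set (Config N) :=
  {X | ∃ (i j : Fin N) (n : Fin 3 → ℤ), i ≠ j ∧ infDist (pairRad L X i j n) (hardRad v) ≤ s}

/-- The **transition zone** of width `3s`: configurations with a pair-image radius within `3s` of, but not at, a hard
radius of `v`. [folklore] -/
def hardZone (v : ℝ → ℝ≥0∞) (L s : ℝ) : Set (Config N) :=
  {X | ∃ (i j : Fin N) (n : Fin 3 → ℤ), i ≠ j ∧ 0 < infDist (pairRad L X i j n) (hardRad v) ∧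
    infDist (pairRad L X i j n) (hardRad v) ≤ 3 * s}

/-- The **softened profile** `v · 1{dist(·, hardRad v) ≥ θ}`: the potential switched off within `θ` of its hard radii.
[folklore] -/
def awayProfile (v : ℝ → ℝ≥0∞) (θ : ℝ) : ℝ → ℝ≥0∞ :=
  {r | θ ≤ infDist r (hardRad v)}.indicator v

variable {v : ℝ → ℝ≥0∞} {L : ℝ}

/-- `pairRad` unfolded. [folklore] -/
theorem pairRad_eq (L : ℝ) (X : Config N) (i j : Fin N) (n : Fin 3 → ℤ) :
    pairRad L X i j n = ‖X i - X j - latticeVec L n‖ := rfl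

/-- The hard layers increase with the width. [folklore] -/
theorem hardLayer_mono (v : ℝ → ℝ≥0∞) (L : ℝ) {s s' : ℝ} (h : s ≤ s') :
    (hardLayer v L s : Set (Config N)) ⊆ hardLayer v L s' := by
  rintro X ⟨i, j, n, hij, hX⟩
  exact ⟨i, j, n, hij, hX.trans h⟩

/-- The transition zones increase with the width. [folklore] -/
theorem hardZone_mono (v : ℝ → ℝ≥0∞) (L : ℝ) {s s' : ℝ} (h : s ≤ s') :
    (hardZone v L s : Set (Config N)) ⊆ hardZone v L s' := by
  rintro X ⟨i, j, n, hij, h0, hX⟩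
  exact ⟨i, j, n, hij, h0, hX.trans (by linarith)⟩

/-- The transition zone lies in the hard layer of triple width. [folklore] -/
theorem hardZone_subset_hardLayer (v : ℝ → ℝ≥0∞) (L s : ℝ) :
    (hardZone v L s : Set (Config N)) ⊆ hardLayer v L (3 * s) := by
  rintro X ⟨i, j, n, hij, -, hX⟩
  exact ⟨i, j, n, hij, hX⟩

/-- The softened profile is dominated by the profile. [folklore] -/
theorem awayProfile_le (v : ℝ → ℝ≥0∞) (θ r : ℝ) : awayProfile v θ r ≤ v r :=
  indicator_le_self _ _ r

/-- Away from the `θ`-neighbourhood of the hard radii the softened profile is the profile. [folklore] -/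
theorem awayProfile_eq_of_le {θ r : ℝ} (h : θ ≤ infDist r (hardRad v)) : awayProfile v θ r = v r :=
  indicator_of_mem (by exact h) _

/-- Within the `θ`-neighbourhood of the hard radii the softened profile vanishes. [folklore] -/
theorem awayProfile_eq_zero_of_lt {θ r : ℝ} (h : infDist r (hardRad v) < θ) : awayProfile v θ r = 0 :=
  indicator_of_notMem (by simpa using h) _

/-- The softened profiles decrease with `θ`. [folklore] -/
theorem awayProfile_anti (v : ℝ → ℝ≥0∞) {θ θ' : ℝ} (h : θ ≤ θ') (r : ℝ) : awayProfile v θ' r ≤ awayProfile v θ r :=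
  indicator_le_indicator_of_subset (fun _ hx => h.trans hx) (fun _ => zero_le) r

/-- The softened profile of a measurable profile is measurable. [folklore] -/
theorem measurable_awayProfile (hv : Measurable v) (θ : ℝ) : Measurable (awayProfile v θ) :=
  hv.indicator (measurableSet_le measurable_const (continuous_infDist_pt _).measurable)

/-- The softened profile inherits the range of the profile. [folklore] -/
theorem awayProfile_eq_zero_of_range {R₀ : ℝ} (hv0 : ∀ r, R₀ < r → v r = 0) (θ : ℝ) {r : ℝ} (hr : R₀ < r) :
    awayProfile v θ r = 0 :=
  nonpos_iff_eq_zero.1 ((awayProfile_le v θ r).trans (hv0 r hr).le)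

end Literature.MathematicalPhysics.QuantumManyBody.BoseGas

end
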